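import Summits.QuantumFields.QCD.Theorems.QuarksAsStableActionWilsonQuarkStabilityStubReflectionStep
import Summits.QuantumFields.QCD.Theorems.QuarksAsStableActionWilsonQuarkStabilityStubStaticSliceBoundAux

/-!
# Helper `mixedSchwarzDet` of line `Sketch` (Route B, step B2 at determinant level, for stub
`stub_heavyFrequencyGain`)
(crux `Summit.QuantumFields.QCD.Theses.QuarksAsStableAction.CriticalLineDiamagnetism`, item stmt-QuantumFields-9734,
static route for odd tori)

**The mixed (site/bond) reflection Schwarz inequality at DETERMINANT level.**  For positive definite one-step
matrices `M_i` and unitary transporters `W_i` on the odd cycle `ZMod (2n+1)`,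
`‖det (1 + ∏_{i<2n+1} M_i W_i)‖² ≤ ‖det (1 + word₊)‖ · ‖det (1 + word₋)‖`, where the reflected word `word₊` keeps
the letters `M_j`, `W_j` of the first half (`j ≤ n`, resp. `j < n`), carries the identity transporter at the
antipodal bond `j = n` and the mirrored letters `M_{−j}`, `(W_{−1−j})ᴴ` on the second half; symmetrically for
`word₋`.

Proof.  This is the trace inequality `stub_reflectionStep` (the mixed reflection step on the odd cycle for words of
positive semidefinite letters `T a` and unitary letters `U b`, `‖Z‖² ≤ ‖Z⁺‖ · ‖Z⁻‖`) applied on the fermionic FOCK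
space `Finset k → ℂ`: take `T a := Γ(M a)` (`Γ = fockLift`, positive definite by `fockLift_posDef'`), unitary
letters indexed by the unitary group itself, `U u := Γ(u)` (unitary by `fockLift_mem_unitaryGroup`), identity
letter `e := 1` (`Γ(1) = 1`) and inversion `ι := star` (`Γ(uᴴ) = Γ(u)ᴴ`).  By functoriality
`Γ(XY) = Γ(X)Γ(Y)` the three Fock words are `Γ` of the three one-particle words, and `Tr Γ(X) = det (1 + X)`
(`trace_fockLift`) turns the three traces into the three determinants — exactly as
`StaticSliceBound.det_one_sub_prod_pow_le` transports the cyclic Hölder inequality.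
Pure theorem file (no definitions).
-/

namespace Summit.QuantumFields.QCD.Cruxes.CriticalLineDiamagnetism.ChessboardCellGain

open Matrix
open scoped ComplexOrder MatrixOrder
open Literature.MathematicalPhysics.QuantumFieldTheory (fockLift)
open Summit.QuantumFields.QCD.Cruxes.StableActionBridge.Sketch
open Summit.QuantumFields.QCD.Cruxes.WilsonQuarkStability.FreeTangentLandauChessboard

/-- Pushing a function through a three-way case distinction `if P then a else if Q then b else c`. -/
theorem MixedSchwarzDet.apply_ite_ite {α β : Sort*} (f : α → β) (P Q : Prop) [Decidable P] [Decidable Q]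
    (a b c : α) : f (if P then a else if Q then b else c) = if P then f a else if Q then f b else f c := by
  split_ifs <;> rfl

/-- The trace of a Fock word `∏_{i<m} Γ(f i) Γ(g i)` is `det (1 + ∏_{i<m} f i * g i)` (functoriality of `Γ` and
`Tr Γ(X) = det (1 + X)`). -/
theorem MixedSchwarzDet.trace_prod_fockLift_mul {k : Type*} [LinearOrder k] [Fintype k] (m : ℕ)
    (f g : ℕ → Matrix k k ℂ) :
    ((List.range m).map fun i : ℕ => fockLift (f i) * fockLift (g i)).prod.trace =
      (1 + ((List.range m).map fun i : ℕ => f i * g i).prod).det := by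
  have : ((List.range m).map fun i : ℕ => fockLift (f i) * fockLift (g i)) =
      ((List.range m).map fun i : ℕ => f i * g i).map fockLift := by
    rw [List.map_map]
    refine List.map_congr_left fun i _ => ?_
    simp only [Function.comp_apply, FockLiftPosDef.fockLift_mul]
  rw [this, ← StaticSliceBound.fockLift_list_prod, FockLiftPosDef.trace_fockLift]

open MixedSchwarzDet in
/-- **Helper `mixedSchwarzDet` (Route B, B2): the mixed site/bond reflection Schwarz inequality at determinant
level** for an odd alternating word of positive definite one-step matrices `M_i` and unitary transporters `W_i`:
`‖det (1 + ∏_{i<2n+1} M_i W_i)‖² ≤ ‖det (1 + word₊)‖ · ‖det (1 + word₋)‖`, the reflected words keeping the first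
half, with the identity at the antipodal bond and the adjoints of the mirrored transporters on the second half
(`stub_reflectionStep` on Fock space, `Tr Γ(X) = det (1 + X)`). -/
theorem mixedSchwarzDet : ∀ {k : Type} [Fintype k] [DecidableEq k] (n : ℕ)
    (M : ZMod (2 * n + 1) → Matrix k k ℂ), (∀ i, (M i).PosDef) →
    ∀ (W : ZMod (2 * n + 1) → Matrix k k ℂ), (∀ i, W i ∈ Matrix.unitaryGroup k ℂ) →
    ‖(1 + ((List.range (2 * n + 1)).map fun i : ℕ => M (i : ZMod (2 * n + 1)) * W (i : ZMod (2 * n + 1))).prod).det‖ ^ 2 ≤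
      ‖(1 + ((List.range (2 * n + 1)).map fun i : ℕ =>
          M ((fun j : ZMod (2 * n + 1) => if j.val ≤ n then j else -j) (i : ZMod (2 * n + 1))) *
            (fun j : ZMod (2 * n + 1) => if j.val < n then W j else if j.val = n then 1 else (W (-1 - j))ᴴ)
              (i : ZMod (2 * n + 1))).prod).det‖ *
      ‖(1 + ((List.range (2 * n + 1)).map fun i : ℕ =>
          M ((fun j : ZMod (2 * n + 1) => if 0 < j.val ∧ j.val ≤ n then -j else j) (i : ZMod (2 * n + 1))) *
            (fun j : ZMod (2 * n + 1) => if j.val < n then (W (-1 - j))ᴴ else if j.val = n then 1 else W j)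
              (i : ZMod (2 * n + 1))).prod).det‖ := by
  intro k _ _ n M hM W hW
  -- a linear order on `k` (to enumerate Fock states), with the ambient decidable equality
  letI lo : LinearOrder k :=
    { le := fun a b => Fintype.equivFin k a ≤ Fintype.equivFin k b
      le_refl := fun a => le_refl _
      le_trans := fun a b c => le_trans
      le_antisymm := fun a b h1 h2 => (Fintype.equivFin k).injective (le_antisymm h1 h2)
      le_total := fun a b => le_total _ _
      toDecidableLE := fun a b => inferInstanceAs (Decidable (Fintype.equivFin k a ≤ Fintype.equivFin k b))
      toDecidableEq := inferInstance }
  -- the letters on Fock space: `T a = Γ(M a)` (positive), `U u = Γ(u)` for `u` unitary, `e = 1`, `ι = star`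
  have hT : ∀ a, (fockLift (M a)).PosSemidef := fun a => (FockLiftPosDef.fockLift_posDef' (hM a)).posSemidef
  have hU : ∀ u : Matrix.unitaryGroup k ℂ, fockLift (u : Matrix k k ℂ) ∈ Matrix.unitaryGroup (Finset k) ℂ :=
    fun u => StaticSliceBound.fockLift_mem_unitaryGroup u.prop
  have he : fockLift ((1 : Matrix.unitaryGroup k ℂ) : Matrix k k ℂ) = 1 := by
    rw [OneMemClass.coe_one, FockLiftPosDef.fockLift_one]
  have hι : ∀ u : Matrix.unitaryGroup k ℂ,
      fockLift ((star u : Matrix.unitaryGroup k ℂ) : Matrix k k ℂ) = (fockLift (u : Matrix k k ℂ))ᴴ := fun u => by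
    rw [Unitary.coe_star, star_eq_conjTranspose, FockLiftPosDef.fockLift_conjTranspose]
  -- the reflection step on Fock space
  have key := stub_reflectionStep n (fun a => fockLift (M a)) hT
    (fun u : Matrix.unitaryGroup k ℂ => fockLift (u : Matrix k k ℂ)) hU 1 he star hι
    (fun j => j) (fun j => (⟨W j, hW j⟩ : Matrix.unitaryGroup k ℂ))
  simp only [apply_ite_ite (Subtype.val), Unitary.coe_star, OneMemClass.coe_one, star_eq_conjTranspose] at key
  rw [trace_prod_fockLift_mul, trace_prod_fockLift_mul, trace_prod_fockLift_mul] at key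
  exact key

end Summit.QuantumFields.QCD.Cruxes.CriticalLineDiamagnetism.ChessboardCellGain
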